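import Literature.Geometry.Lorentzian.KerrSliceAgmon
import Literature.Geometry.Lorentzian.KerrSliceHardy
import HarnessLib

/-!
# Coercivity of the energy flux through the hyperboloidal leaves `Σ̃_τ(h♯_{R₁})`:
# hypothesis (D1) of the assembly of DRSR Corollary 3.1 (30) from the first flux estimate

(statement group **gr.S24**; namespace `Literature.Geometry.Lorentzian.Kerr`, glue in
`Literature.Geometry.Lorentzian`)

`KerrPointwiseDecayHierarchy.lean` and `KerrSliceAgmon.lean` prove the pointwise decay estimate (30)
of Dafermos–Rodnianski–Shlapentokh-Rothman (arXiv:1402.7034 = Ann. of Math. 183 (2016), "DRSR",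
Cor. 3.1) — in the leaf form `sup_{Σ̃_τ(h♯_{R₁}) ∩ {r₊ < r ≤ R}} |ψ| ≤ C τ^{-3/2+δ}`, equivalent to the
gr.S24 named fact `Literature.Geometry.Lorentzian.drsr_wave_pointwise_decay_kerr` — from one
explicit hypothesis (D) = (D1) ∧ (D2) ∧ (D3) on the energies of the wave through the hyperboloidal
leaves `Σ̃_τ(h♯_{R₁})` (`Kerr.scriHeight`; `KerrHyperboloidalFlux.lean`), the interpolation input
(GN) being proved there. This file **proves (D1)** — the decay `A(τ) ≤ C τ⁻²` of the first-order
Cartesian leaf energy `A(τ) = ∫_S (‖DΨ_τ‖² + ‖y‖⁻²((TΨ)_τ)²) dy` (`Kerr.leafGradEnergy`) — **from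
the named fact `Kerr.drsr_corollary_3_1_scri_flux_decay`** of `KerrHyperboloidalFlux.lean` (DRSR
Cor. 3.1, first estimate: `∫_{Σ̃_τ} J^V_μ[ψ] n^μ ≤ C τ⁻²`, itself reduced to DRSR Thms. 3.1–3.2 and
the `r^p` estimates in `KerrDecayHierarchy.lean`), through a pointwise **coercivity estimate for
the flux density `T[ψ](V, W)` through the leaves**, `W = −g♯d(t* − h)`:

* `Kerr.leafCoercivity_alg`: the algebra. In Kerr–Schild components (`g⁻¹ = η⁻¹ − 2H ℓ♯ ⊗ ℓ♯`,
  `V = ∂_{t*} − 2Hℓ♯`, `ν = dt* − k`, `k = dh`, `p = dψ = (s, p⃗)`) one has the identity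
  `2ν(V)(1 + 2H) T[ψ](V, W) = (1 + 2H)|Ũ|² − 2H(ℓ⃗·Ũ)² + (1 + 2H)(−g⁻¹(ν, ν)) (dψ(V))²`,
  `Ũ = ν(V) p⃗ + dψ(V) k⃗` (completing the square), while the Cartesian leaf gradient
  `q⃗ = p⃗ + s k⃗` and `s = Tψ` satisfy `ν(V) q⃗ = Ũ + 2H(ℓ⃗·q⃗) k⃗`, `ν(V) s = dψ(V) + 2H(ℓ⃗·q⃗)`,
  `(1 + 2H)(ℓ⃗·q⃗) = ℓ⃗·Ũ`; hence `|q⃗|² ≤ 876 T` and `(−g⁻¹(ν, ν)) s² ≤ 1588 T` for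
  `0 ≤ H ≤ 1`, `|k⃗|² ≤ 18`, `k⃗·ℓ⃗ ≥ 0`, `0 ≤ −g⁻¹(ν, ν) ≤ 33`. The only degenerate direction of
  `T(V, W)` as the leaf becomes null (`g⁻¹(ν, ν) → 0`) is transversal to the leaf: the tangential
  gradient is controlled uniformly, the time derivative with the weight `−g⁻¹(ν, ν)`;
* `Kerr.scriSlope_lt_three`, `Kerr.scri_quartic_le`, `Kerr.sq_sub_leafQuadratic_scriSlope_ge`,
  `Kerr.sq_sub_leafQuadratic_ge`: the slopes `c ∈ [0, σ♯(r)]` of the cut-off leaves are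
  **uniformly** spacelike, `r² − P(c) ≥ M²`, `P(c) = c²(r² + a²) − 2Mr(1 + c)²` (quantitative forms
  of `Kerr.leafQuadratic_lt_sq` of `KerrHyperboloidalLeaves.lean`: `P(σ♯) ≤ r² − (7/4)M²` from the
  quartic `N ≤ −(7/4)M²r⁴`), whence `−g⁻¹(ν, ν) = (Σ − P(c))/Σ ≥ M²/Σ ≥ M²/(2‖y‖²)`: this is the
  rate `∼ M²/r²` at which the leaves `Σ̃_τ(h♯_{R₁})` fail to be null, and the origin of the weight
  `r⁻²` on `(Tψ)²` in DRSR's/Moschidis' hyperboloidal energies;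
* `Kerr.leafCoercivity_pointwise_core`, `Kerr.leafCoercivity_pointwise` (**proved**): at every
  exterior point of a leaf of a cut-off graph foliation `h = cutoffHeight σ a R₁` (`0 ≤ σ ≤ σ♯`,
  `R₁ ≥ 4M`), `∑ᵢ (pᵢ + ∂ᵢh p₀)² + ‖y‖⁻² p₀² ≤ (876 + 3176/M²) T[ψ](V, W)`;
* `Kerr.fderiv_leafFun_apply_single`, `Kerr.leafFun_timeDeriv_apply`: the chain rule
  `∂_{yᵢ}Ψ_τ = pᵢ₊₁ + ∂ᵢh p₀`, `(TΨ)_τ = p₀` along the leaf;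
* `Kerr.leafGradEnergy_le_leafFlux`, `Kerr.leafGradEnergy_scriHeight_le_leafFlux` (**proved**):
  `A(τ) ≤ (876 + 3176/M²) ∫_{Σ̃_τ(h)} J^V_μ[ψ] n^μ` (integration over `S = {r(0, ·) > r₊}`);
* `Kerr.leafGradEnergy_decay_of_flux_decay` (**proved**): (D1) from
  `Kerr.drsr_corollary_3_1_scri_flux_decay`, threshold radius `max(R₀, 4M)`;
* `Kerr.drsr_corollary_3_1_scri_pointwise_decay_of_flux_decay`,
  `Literature.Geometry.Lorentzian.drsr_wave_pointwise_decay_kerr_of_flux_decay`,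
  `Literature.Geometry.Lorentzian.drsr_wave_pointwise_decay_kerr_of_hierarchy` (**proved**): the
  leaf form of (30) and the gr.S24 fact from the flux-decay fact — respectively from facts A
  (`Kerr.drsr_theorems_3_1_3_2_scri`) and B (`Kerr.dafermosRodnianski_pHierarchy_scri`) of
  `KerrDecayHierarchy.lean` — together with (D2) and (D3) only.

In the source this is the comparability `∫_{Σ̃_τ} J^N_μ[ψ] n^μ_{Σ̃_τ} ∼ ∫ (|∇_{Σ̃_τ}ψ|² + r⁻²(Tψ)²)`
of the non-degenerate energy flux through an asymptotically hyperboloidal leaf with the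
first-order quantities on it (DRSR §3.1 (28) with §3.3; Moschidis arXiv:1509.08489, Thm. 8.1, whose
energy is `∫_{t̄=τ}(|∇_{h_{τ,N}}φ|²_h + r⁻²|Tφ|²) dh_N`), made quantitative for the concrete leaves
and the Cartesian rendering (a)–(d) of `KerrPointwiseDecayHierarchy.lean`. Everything below is
proved; no named facts are introduced. What remains assumed in the gr.S24 chain
`drsr_wave_pointwise_decay_kerr ⟸ …` is (D2) (second-order improved decay `τ^{-4+2δ}`: DRSR
Cor. 3.1, second estimate / Moschidis Thm. 9.1, `q = 2`) and (D3) (finite radiation field on each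
leaf: Cor. 3.1, third estimate / Moschidis Thm. 7.1), besides the flux-decay fact (resp. facts A, B).

## References

* M. Dafermos, I. Rodnianski, Y. Shlapentokh-Rothman, *Decay for solutions of the wave equation on
  Kerr exterior spacetimes III: the full subextremal case |a| < M*, arXiv:1402.7034 = Ann. of
  Math. 183 (2016), §3.1 (28), §3.3 Cor. 3.1 (key `DafermosRodnianskiShlapentokhrothman2014`).
* G. Moschidis, *The r^p-weighted energy method of Dafermos and Rodnianski in general
  asymptotically flat spacetimes and applications*, arXiv:1509.08489 = Ann. PDE 2 (2016), §1.3.3,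
  Thm. 8.1, §9.4 (key `Moschidis2016`).
* R. P. Kerr, A. Schild, 1965, §2 (the inverse metric `g⁻¹ = η⁻¹ − 2H ℓ♯ ⊗ ℓ♯`; key
  `KerrSchild1965`).
-/

noncomputable section

open Set Filter MeasureTheory Metric Module
open scoped Topology ENNReal ContDiff RealInnerProductSpace Manifold

namespace Literature.Geometry.Lorentzian

namespace Kerr

/-! ### The algebra of the coercivity: completing the square in `T[ψ](V, W)` -/

/-- Cauchy–Schwarz against a Euclidean unit vector in `ℝ³`, by Lagrange's identity:
`(ℓ⃗ · U⃗)² ≤ |U⃗|²` for `|ℓ⃗| = 1`. [folklore] -/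
theorem inner_unit_sq_le (l₁ l₂ l₃ U₁ U₂ U₃ : ℝ) (hl : l₁ ^ 2 + l₂ ^ 2 + l₃ ^ 2 = 1) :
    (l₁ * U₁ + l₂ * U₂ + l₃ * U₃) ^ 2 ≤ U₁ ^ 2 + U₂ ^ 2 + U₃ ^ 2 := by
  have hlag : (U₁ ^ 2 + U₂ ^ 2 + U₃ ^ 2) * (l₁ ^ 2 + l₂ ^ 2 + l₃ ^ 2) -
      (l₁ * U₁ + l₂ * U₂ + l₃ * U₃) ^ 2 =
        (l₁ * U₂ - l₂ * U₁) ^ 2 + (l₁ * U₃ - l₃ * U₁) ^ 2 + (l₂ * U₃ - l₃ * U₂) ^ 2 := by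
    ring
  rw [hl, mul_one] at hlag
  nlinarith [hlag, sq_nonneg (l₁ * U₂ - l₂ * U₁), sq_nonneg (l₁ * U₃ - l₃ * U₁),
    sq_nonneg (l₂ * U₃ - l₃ * U₂)]

/-- **The algebra of the leaf-flux coercivity (completing the square in `T[ψ](V, W)`).** In
Kerr–Schild components at a point (`H ≥ 0` the Kerr–Schild scalar, `ℓ⃗ = (l₁, l₂, l₃)` the unit
spatial part of the null vector, `k⃗` the differential of the height function, `kl = k⃗·ℓ⃗`,
`p = dψ = (s, p⃗)`): with `ν = dt* − k`, `ν(V) = 1 + 2H(1 + kl)`, `dψ(V) = (1 + 2H)s − 2H(ℓ⃗·p⃗)`,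
`g⁻¹(p, p) = −s² + |p⃗|² − 2H(−s + ℓ⃗·p⃗)²`, `g⁻¹(p, ν) = −s − k⃗·p⃗ − 2H(1 + kl)(s − ℓ⃗·p⃗)`, the flux
density `T = T[ψ](V, −g♯ν) = −dψ(V) g⁻¹(p, ν) + ½ ν(V) g⁻¹(p, p)` satisfies
`2ν(V)(1 + 2H) T = (1 + 2H)|Ũ|² − 2H(ℓ⃗·Ũ)² + (1 + 2H) γ (dψ(V))²` with `Ũ = ν(V) p⃗ + dψ(V) k⃗`,
`γ = 1 − |k⃗|² + 2H(1 + kl)² = −g⁻¹(ν, ν)`, and the leaf gradient `q⃗ = p⃗ + s k⃗` obeys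
`ν(V) q⃗ = Ũ + 2H(ℓ⃗·q⃗) k⃗`, `ν(V) s = dψ(V) + 2H(ℓ⃗·q⃗)`, `(1 + 2H)(ℓ⃗·q⃗) = ℓ⃗·Ũ`. Consequently,
for `0 ≤ H ≤ 1`, `|ℓ⃗| = 1`, `|k⃗|² ≤ 18`, `kl ≥ 0` and `0 ≤ γ ≤ 33`:
`|q⃗|² ≤ 876 T` and `γ s² ≤ 1588 T`. Elementary; it quantifies DRSR arXiv:1402.7034, §3.1 (28)
(`∫ J^N_μ n^μ ∼ ‖∂ψ‖²` on spacelike leaves) for the asymptotically hyperboloidal leaves. [folklore] -/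
theorem leafCoercivity_alg (H s p₁ p₂ p₃ k₁ k₂ k₃ l₁ l₂ l₃ kl : ℝ) (hH0 : 0 ≤ H) (hH1 : H ≤ 1)
    (hl : l₁ ^ 2 + l₂ ^ 2 + l₃ ^ 2 = 1) (hK : k₁ ^ 2 + k₂ ^ 2 + k₃ ^ 2 ≤ 18)
    (hkl_eq : k₁ * l₁ + k₂ * l₂ + k₃ * l₃ = kl) (hkl : 0 ≤ kl)
    (hγ0 : 0 ≤ 1 - (k₁ ^ 2 + k₂ ^ 2 + k₃ ^ 2) + 2 * H * (1 + kl) ^ 2)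
    (hγ1 : 1 - (k₁ ^ 2 + k₂ ^ 2 + k₃ ^ 2) + 2 * H * (1 + kl) ^ 2 ≤ 33) :
    (p₁ + k₁ * s) ^ 2 + (p₂ + k₂ * s) ^ 2 + (p₃ + k₃ * s) ^ 2 ≤
        876 * (-((1 + 2 * H) * s - 2 * H * (l₁ * p₁ + l₂ * p₂ + l₃ * p₃)) *
            (-s - (k₁ * p₁ + k₂ * p₂ + k₃ * p₃) -
              2 * H * (1 + kl) * (s - (l₁ * p₁ + l₂ * p₂ + l₃ * p₃))) +
          (1 + 2 * H * (1 + kl)) / 2 *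
            (-s ^ 2 + (p₁ ^ 2 + p₂ ^ 2 + p₃ ^ 2) -
              2 * H * (-s + (l₁ * p₁ + l₂ * p₂ + l₃ * p₃)) ^ 2)) ∧
      (1 - (k₁ ^ 2 + k₂ ^ 2 + k₃ ^ 2) + 2 * H * (1 + kl) ^ 2) * s ^ 2 ≤
        1588 * (-((1 + 2 * H) * s - 2 * H * (l₁ * p₁ + l₂ * p₂ + l₃ * p₃)) *
            (-s - (k₁ * p₁ + k₂ * p₂ + k₃ * p₃) -
              2 * H * (1 + kl) * (s - (l₁ * p₁ + l₂ * p₂ + l₃ * p₃))) +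
          (1 + 2 * H * (1 + kl)) / 2 *
            (-s ^ 2 + (p₁ ^ 2 + p₂ ^ 2 + p₃ ^ 2) -
              2 * H * (-s + (l₁ * p₁ + l₂ * p₂ + l₃ * p₃)) ^ 2)) := by
  subst hkl_eq
  have hK0 : 0 ≤ k₁ ^ 2 + k₂ ^ 2 + k₃ ^ 2 := by positivity
  have h12H : 1 ≤ 1 + 2 * H := by linarith
  have h12H0 : 0 < 1 + 2 * H := by linarith
  have h12H3 : 1 + 2 * H ≤ 3 := by linarith
  have hH2 : H ^ 2 ≤ 1 := by
    rw [pow_two]; exact mul_le_one₀ hH1 hH0 hH1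
  set m : ℝ := l₁ * p₁ + l₂ * p₂ + l₃ * p₃ with hm
  set kl : ℝ := k₁ * l₁ + k₂ * l₂ + k₃ * l₃ with hkl_def
  set kp : ℝ := k₁ * p₁ + k₂ * p₂ + k₃ * p₃ with hkp
  set K2 : ℝ := k₁ ^ 2 + k₂ ^ 2 + k₃ ^ 2 with hK2
  set P : ℝ := p₁ ^ 2 + p₂ ^ 2 + p₃ ^ 2 with hP
  set pV : ℝ := (1 + 2 * H) * s - 2 * H * m with hpV
  set Λ : ℝ := 1 + 2 * H * (1 + kl) with hΛ
  set γ : ℝ := 1 - K2 + 2 * H * (1 + kl) ^ 2 with hγ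
  set T : ℝ := -pV * (-s - kp - 2 * H * (1 + kl) * (s - m)) +
    Λ / 2 * (-s ^ 2 + P - 2 * H * (-s + m) ^ 2) with hT
  -- the completed square `Ũ = Λ p⃗ + p(V) k⃗`
  set U₁ : ℝ := Λ * p₁ + pV * k₁ with hU₁
  set U₂ : ℝ := Λ * p₂ + pV * k₂ with hU₂
  set U₃ : ℝ := Λ * p₃ + pV * k₃ with hU₃
  set lU : ℝ := l₁ * U₁ + l₂ * U₂ + l₃ * U₃ with hlU
  set NU : ℝ := U₁ ^ 2 + U₂ ^ 2 + U₃ ^ 2 with hNU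
  -- the leaf gradient `q⃗ = p⃗ + s k⃗` and `ℓ⃗ · q⃗`
  set q₁ : ℝ := p₁ + k₁ * s with hq₁
  set q₂ : ℝ := p₂ + k₂ * s with hq₂
  set q₃ : ℝ := p₃ + k₃ * s with hq₃
  set lq : ℝ := l₁ * q₁ + l₂ * q₂ + l₃ * q₃ with hlq
  -- MASTER identity: `2Λ(1+2H) T = (1+2H)|Ũ|² − 2H(ℓ⃗·Ũ)² + (1+2H) γ p(V)²`
  have master : 2 * Λ * (1 + 2 * H) * T =
      (1 + 2 * H) * NU - 2 * H * lU ^ 2 + (1 + 2 * H) * γ * pV ^ 2 := by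
    simp only [hT, hNU, hlU, hU₁, hU₂, hU₃, hγ, hΛ, hpV, hm, hkl_def, hkp, hK2, hP]
    ring
  -- relations between `q⃗`, `s` and `Ũ`, `p(V)`
  have rq₁ : Λ * q₁ = U₁ + 2 * H * lq * k₁ := by
    simp only [hq₁, hU₁, hlq, hq₂, hq₃, hΛ, hpV, hm, hkl_def]; ring
  have rq₂ : Λ * q₂ = U₂ + 2 * H * lq * k₂ := by
    simp only [hq₁, hU₂, hlq, hq₂, hq₃, hΛ, hpV, hm, hkl_def]; ring
  have rq₃ : Λ * q₃ = U₃ + 2 * H * lq * k₃ := by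
    simp only [hq₁, hU₃, hlq, hq₂, hq₃, hΛ, hpV, hm, hkl_def]; ring
  have rs : Λ * s = pV + 2 * H * lq := by
    simp only [hlq, hq₁, hq₂, hq₃, hΛ, hpV, hm, hkl_def]; ring
  have rl : (1 + 2 * H) * lq = lU := by
    simp only [hlq, hq₁, hq₂, hq₃, hlU, hU₁, hU₂, hU₃, hΛ, hpV, hm, hkl_def]; ring
  -- positivity bookkeeping
  have hΛ1 : 1 ≤ Λ := by
    have : 0 ≤ 2 * H * (1 + kl) := mul_nonneg (by linarith) (by linarith)
    rw [hΛ]; linarith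
  have hΛ0 : 0 < Λ := by linarith
  have hCS : lU ^ 2 ≤ NU := by
    rw [hlU, hNU]; exact inner_unit_sq_le l₁ l₂ l₃ U₁ U₂ U₃ hl
  have hNU0 : 0 ≤ NU := by rw [hNU]; positivity
  have hQ0 : 0 ≤ q₁ ^ 2 + q₂ ^ 2 + q₃ ^ 2 := by positivity
  have hΛq : Λ ^ 2 * (q₁ ^ 2 + q₂ ^ 2 + q₃ ^ 2) = (Λ * q₁) ^ 2 + (Λ * q₂) ^ 2 + (Λ * q₃) ^ 2 := by
    ring
  -- make the abbreviations opaque and drop the (large) defining equations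
  clear_value m kl kp K2 P pV Λ γ T U₁ U₂ U₃ lU NU q₁ q₂ q₃ lq
  clear hT hU₁ hU₂ hU₃ hlU hq₁ hq₂ hq₃ hlq hpV hγ hΛ hm hkl_def hkp hP
  -- (B1) `|Ũ|² ≤ 2Λ(1+2H) T`, `0 ≤ T`, `γ p(V)² ≤ 2Λ T`
  have h2 : 0 ≤ 2 * H * (NU - lU ^ 2) := mul_nonneg (by linarith) (by linarith)
  have h3 : 0 ≤ (1 + 2 * H) * γ * pV ^ 2 := mul_nonneg (mul_nonneg h12H0.le hγ0) (sq_nonneg _)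
  have hB1 : NU ≤ 2 * Λ * (1 + 2 * H) * T := by linarith [master, h2, h3]
  have hc : 0 < 2 * Λ * (1 + 2 * H) := mul_pos (mul_pos two_pos hΛ0) h12H0
  have hT0 : 0 ≤ T := by
    refine le_of_mul_le_mul_left ?_ hc
    rw [mul_zero]; exact hNU0.trans hB1
  have hB1' : γ * pV ^ 2 ≤ 2 * Λ * T := by
    refine le_of_mul_le_mul_left ?_ h12H0
    linarith [master, h2, hNU0]
  -- `(ℓ⃗·q⃗)² ≤ |Ũ|²`
  have hlq2 : lq ^ 2 ≤ NU := by
    have h1 : lU ^ 2 = (1 + 2 * H) ^ 2 * lq ^ 2 := by rw [← rl]; ring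
    have h4 : 0 ≤ ((1 + 2 * H) ^ 2 - 1) * lq ^ 2 := by
      have : (1 + 2 * H) ^ 2 - 1 = 4 * H + 4 * H ^ 2 := by ring
      rw [this]; positivity
    linarith [h1, h4, hCS]
  -- (B2) the leaf gradient
  have hq_sq : Λ ^ 2 * (q₁ ^ 2 + q₂ ^ 2 + q₃ ^ 2) ≤ (2 + 8 * H ^ 2 * K2) * NU := by
    have e₁ : (Λ * q₁) ^ 2 ≤ 2 * U₁ ^ 2 + 8 * H ^ 2 * lq ^ 2 * k₁ ^ 2 := by
      rw [rq₁]
      calc (U₁ + 2 * H * lq * k₁) ^ 2 ≤ 2 * (U₁ ^ 2 + (2 * H * lq * k₁) ^ 2) := add_sq_le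
        _ = 2 * U₁ ^ 2 + 8 * H ^ 2 * lq ^ 2 * k₁ ^ 2 := by ring
    have e₂ : (Λ * q₂) ^ 2 ≤ 2 * U₂ ^ 2 + 8 * H ^ 2 * lq ^ 2 * k₂ ^ 2 := by
      rw [rq₂]
      calc (U₂ + 2 * H * lq * k₂) ^ 2 ≤ 2 * (U₂ ^ 2 + (2 * H * lq * k₂) ^ 2) := add_sq_le
        _ = 2 * U₂ ^ 2 + 8 * H ^ 2 * lq ^ 2 * k₂ ^ 2 := by ring
    have e₃ : (Λ * q₃) ^ 2 ≤ 2 * U₃ ^ 2 + 8 * H ^ 2 * lq ^ 2 * k₃ ^ 2 := by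
      rw [rq₃]
      calc (U₃ + 2 * H * lq * k₃) ^ 2 ≤ 2 * (U₃ ^ 2 + (2 * H * lq * k₃) ^ 2) := add_sq_le
        _ = 2 * U₃ ^ 2 + 8 * H ^ 2 * lq ^ 2 * k₃ ^ 2 := by ring
    have e : Λ ^ 2 * (q₁ ^ 2 + q₂ ^ 2 + q₃ ^ 2) ≤ 2 * NU + 8 * H ^ 2 * lq ^ 2 * K2 := by
      have hsum : 2 * NU + 8 * H ^ 2 * lq ^ 2 * K2 =
          (2 * U₁ ^ 2 + 8 * H ^ 2 * lq ^ 2 * k₁ ^ 2) + (2 * U₂ ^ 2 + 8 * H ^ 2 * lq ^ 2 * k₂ ^ 2) +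
            (2 * U₃ ^ 2 + 8 * H ^ 2 * lq ^ 2 * k₃ ^ 2) := by
        rw [hNU, hK2]; ring
      rw [hΛq, hsum]; linarith [e₁, e₂, e₃]
    have f : 8 * H ^ 2 * lq ^ 2 * K2 ≤ 8 * H ^ 2 * NU * K2 := by
      have := mul_le_mul_of_nonneg_left hlq2 (by positivity : (0 : ℝ) ≤ 8 * H ^ 2)
      exact mul_le_mul_of_nonneg_right this hK0
    have g : (2 + 8 * H ^ 2 * K2) * NU = 2 * NU + 8 * H ^ 2 * NU * K2 := by ring
    rw [g]; linarith [e, f]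
  have hq_T : Λ * (q₁ ^ 2 + q₂ ^ 2 + q₃ ^ 2) ≤ (4 + 16 * H ^ 2 * K2) * (1 + 2 * H) * T := by
    have hc0 : 0 ≤ 2 + 8 * H ^ 2 * K2 := by positivity
    have h1 : Λ ^ 2 * (q₁ ^ 2 + q₂ ^ 2 + q₃ ^ 2) ≤
        (2 + 8 * H ^ 2 * K2) * (2 * Λ * (1 + 2 * H) * T) :=
      hq_sq.trans (mul_le_mul_of_nonneg_left hB1 hc0)
    refine le_of_mul_le_mul_left ?_ hΛ0
    calc Λ * (Λ * (q₁ ^ 2 + q₂ ^ 2 + q₃ ^ 2)) = Λ ^ 2 * (q₁ ^ 2 + q₂ ^ 2 + q₃ ^ 2) := by ring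
      _ ≤ (2 + 8 * H ^ 2 * K2) * (2 * Λ * (1 + 2 * H) * T) := h1
      _ = Λ * ((4 + 16 * H ^ 2 * K2) * (1 + 2 * H) * T) := by ring
  have hq_fin : q₁ ^ 2 + q₂ ^ 2 + q₃ ^ 2 ≤ 876 * T := by
    have hHK : H ^ 2 * K2 ≤ 1 * 18 := mul_le_mul hH2 hK hK0 zero_le_one
    have h1 : (4 + 16 * H ^ 2 * K2) * (1 + 2 * H) ≤ 292 * 3 :=
      mul_le_mul (by linarith) h12H3 h12H0.le (by norm_num)
    have h2 : 1 * (q₁ ^ 2 + q₂ ^ 2 + q₃ ^ 2) ≤ Λ * (q₁ ^ 2 + q₂ ^ 2 + q₃ ^ 2) :=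
      mul_le_mul_of_nonneg_right hΛ1 hQ0
    have h3 := mul_le_mul_of_nonneg_right h1 hT0
    linarith [hq_T]
  -- (B3) the time derivative with the weight `γ`
  have hs_sq : γ * (Λ * s) ^ 2 ≤ 2 * (γ * pV ^ 2) + 8 * H ^ 2 * γ * lq ^ 2 := by
    rw [rs]
    calc γ * (pV + 2 * H * lq) ^ 2 ≤ γ * (2 * (pV ^ 2 + (2 * H * lq) ^ 2)) :=
          mul_le_mul_of_nonneg_left add_sq_le hγ0
      _ = 2 * (γ * pV ^ 2) + 8 * H ^ 2 * γ * lq ^ 2 := by ring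
  have hs_T : Λ * (γ * s ^ 2) ≤ (4 + 16 * H ^ 2 * γ * (1 + 2 * H)) * T := by
    have h1 : 8 * H ^ 2 * γ * lq ^ 2 ≤ 8 * H ^ 2 * γ * (2 * Λ * (1 + 2 * H) * T) :=
      mul_le_mul_of_nonneg_left (hlq2.trans hB1) (by positivity)
    refine le_of_mul_le_mul_left ?_ hΛ0
    calc Λ * (Λ * (γ * s ^ 2)) = γ * (Λ * s) ^ 2 := by ring
      _ ≤ 2 * (γ * pV ^ 2) + 8 * H ^ 2 * γ * lq ^ 2 := hs_sq
      _ ≤ 2 * (2 * Λ * T) + 8 * H ^ 2 * γ * (2 * Λ * (1 + 2 * H) * T) := by linarith [hB1', h1]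
      _ = Λ * ((4 + 16 * H ^ 2 * γ * (1 + 2 * H)) * T) := by ring
  have hs_fin : γ * s ^ 2 ≤ 1588 * T := by
    have hHγ : H ^ 2 * γ ≤ 1 * 33 := mul_le_mul hH2 hγ1 hγ0 zero_le_one
    have hHγ3 : H ^ 2 * γ * (1 + 2 * H) ≤ 1 * 33 * 3 :=
      mul_le_mul hHγ h12H3 h12H0.le (by norm_num)
    have h1 : 4 + 16 * H ^ 2 * γ * (1 + 2 * H) ≤ 1588 := by linarith
    have h2 : 1 * (γ * s ^ 2) ≤ Λ * (γ * s ^ 2) :=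
      mul_le_mul_of_nonneg_right hΛ1 (mul_nonneg hγ0 (sq_nonneg _))
    have h3 := mul_le_mul_of_nonneg_right h1 hT0
    linarith [hs_T]
  exact ⟨hq_fin, hs_fin⟩


/-! ### Ranges of the Kerr–Schild quantities along the leaves `Σ̃_τ(h)` -/

/-- `σ♯(r) < 3` for `r ≥ 4M` (`Δ ≥ r²/2` there, so `(r² + a²)/Δ ≤ 9/4`, and `2M/r ≤ 1/2`).
[folklore] -/
theorem scriSlope_lt_three {M a r : ℝ} (h : IsSubextremal M a) (hr : 4 * M ≤ r) :
    scriSlope M a r < 3 := by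
  have hM := h.pos
  have hr0 : 0 < r := by linarith
  have ha : a ^ 2 < M ^ 2 := h.sq_lt_sq
  have hD : (r - rPlus M a) * (r - rMinus M a) = r ^ 2 - 2 * M * r + a ^ 2 :=
    sub_rPlus_mul_sub_rMinus ha.le r
  unfold scriSlope
  rw [hD]
  have hMr : M * r ≤ r ^ 2 / 4 := by nlinarith
  have hΔ : r ^ 2 / 2 ≤ r ^ 2 - 2 * M * r + a ^ 2 := by nlinarith [sq_nonneg a]
  have hΔpos : 0 < r ^ 2 - 2 * M * r + a ^ 2 := by
    have : 0 < r ^ 2 / 2 := by positivity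
    linarith
  have hM2 : M ^ 2 ≤ r ^ 2 / 16 := by nlinarith
  have h1 : (r ^ 2 + a ^ 2) / (r ^ 2 - 2 * M * r + a ^ 2) ≤ 9 / 4 := by
    rw [div_le_iff₀ hΔpos]; nlinarith
  have h2 : 2 * M / r ≤ 1 / 2 := by
    rw [div_le_iff₀ hr0]; linarith
  linarith

/-- The quartic of `Kerr.scri_quartic_neg`, quantitatively: for `0 < M`, `0 ≤ b < M²` and
`r ≥ 2M`, `N ≤ −(7/4) M² r⁴` (the termwise bounds `(−7, 1, 4, 0, ¼) M² r⁴` of loc. cit.).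
[folklore] -/
theorem scri_quartic_le {M b r : ℝ} (hM : 0 < M) (hb0 : 0 ≤ b) (hb : b < M ^ 2)
    (hr : 2 * M ≤ r) :
    (b - 8 * M ^ 2) * r ^ 4 + 2 * M * b * r ^ 3 + (b - 4 * M ^ 2) ^ 2 * r ^ 2 +
        4 * M * b * (b - 4 * M ^ 2) * r + 4 * M ^ 2 * b ^ 2 ≤ -(7 / 4) * M ^ 2 * r ^ 4 := by
  have hr0 : 0 < r := by linarith
  have hM2 : 0 < M ^ 2 := by positivity
  have hr4 : 0 < r ^ 4 := by positivity
  have T1 : (b - 8 * M ^ 2) * r ^ 4 ≤ -7 * M ^ 2 * r ^ 4 :=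
    mul_le_mul_of_nonneg_right (by linarith) hr4.le
  have T2 : 2 * M * b * r ^ 3 ≤ M ^ 2 * r ^ 4 := by
    have h1 : 2 * M * b * r ^ 3 ≤ 2 * M * M ^ 2 * r ^ 3 := by gcongr
    have h2 : 0 ≤ M ^ 2 * r ^ 3 * (r - 2 * M) :=
      mul_nonneg (by positivity) (by linarith)
    nlinarith [h1, h2]
  have T3 : (b - 4 * M ^ 2) ^ 2 * r ^ 2 ≤ 4 * M ^ 2 * r ^ 4 := by
    have h1 : (b - 4 * M ^ 2) ^ 2 ≤ 16 * M ^ 4 := by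
      nlinarith [mul_nonneg hb0 (by linarith : 0 ≤ 8 * M ^ 2 - b)]
    have h2 : (b - 4 * M ^ 2) ^ 2 * r ^ 2 ≤ 16 * M ^ 4 * r ^ 2 :=
      mul_le_mul_of_nonneg_right h1 (sq_nonneg r)
    have h3 : 4 * M ^ 2 ≤ r ^ 2 := by nlinarith
    have h4 : 0 ≤ 4 * M ^ 2 * r ^ 2 * (r ^ 2 - 4 * M ^ 2) :=
      mul_nonneg (by positivity) (by linarith)
    nlinarith [h2, h4]
  have T4 : 4 * M * b * (b - 4 * M ^ 2) * r ≤ 0 := by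
    have h1 : 0 ≤ 4 * M * b * r * (4 * M ^ 2 - b) :=
      mul_nonneg (by positivity) (by linarith)
    nlinarith [h1]
  have T5 : 4 * M ^ 2 * b ^ 2 ≤ M ^ 2 * r ^ 4 / 4 := by
    have h1 : b ^ 2 ≤ (M ^ 2) ^ 2 := pow_le_pow_left₀ hb0 hb.le 2
    have h2 : (2 * M) ^ 4 ≤ r ^ 4 := pow_le_pow_left₀ (by linarith) hr 4
    nlinarith [h1, h2, mul_le_mul_of_nonneg_left h1 (by positivity : (0 : ℝ) ≤ 4 * M ^ 2)]
  linarith [T1, T2, T3, T4, T5]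

/-- **The far slope is uniformly spacelike**: `r² − P(σ♯(r)) ≥ (7/4) M²` for `|a| < M`,
`r > r₊`, `r ≥ 2M`, where `P(c) = c²(r² + a²) − 2Mr(1 + c)²` (quantitative form of
`Kerr.leafQuadratic_scriSlope_lt_sq`: `(rΔ)²(r² − P(σ♯)) = −ΔN ≥ (7/4)M² r⁴ Δ` and `Δ ≤ r²`).
[folklore] -/
theorem sq_sub_leafQuadratic_scriSlope_ge {M a r : ℝ} (h : IsSubextremal M a)
    (hrp : rPlus M a < r) (hr : 2 * M ≤ r) :
    7 / 4 * M ^ 2 ≤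
      r ^ 2 - (scriSlope M a r ^ 2 * (r ^ 2 + a ^ 2) - 2 * M * r * (1 + scriSlope M a r) ^ 2) := by
  have hM := h.pos
  have hr0 : 0 < r := h.rPlus_pos.trans hrp
  set D : ℝ := (r - rPlus M a) * (r - rMinus M a) with hD
  have hDeq : D = r ^ 2 - 2 * M * r + a ^ 2 := sub_rPlus_mul_sub_rMinus h.sq_lt_sq.le r
  have hDpos : 0 < D := sub_rPlus_mul_sub_rMinus_pos hrp
  set s : ℝ := scriSlope M a r with hs
  have hw : s * (r * D) = r * (r ^ 2 + a ^ 2) + 2 * M * D := by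
    rw [hs, scriSlope, ← hD]
    field_simp
  have hid : (r * D) ^ 2 * (r ^ 2 - (s ^ 2 * (r ^ 2 + a ^ 2) - 2 * M * r * (1 + s) ^ 2)) =
      -D * ((a ^ 2 - 8 * M ^ 2) * r ^ 4 + 2 * M * a ^ 2 * r ^ 3 + (a ^ 2 - 4 * M ^ 2) ^ 2 * r ^ 2 +
        4 * M * a ^ 2 * (a ^ 2 - 4 * M ^ 2) * r + 4 * M ^ 2 * (a ^ 2) ^ 2) := by
    rw [hDeq] at hw ⊢
    linear_combination
      (-(r ^ 2 + a ^ 2) * (r * (r ^ 2 - 2 * M * r + a ^ 2) * s +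
            (r * (r ^ 2 + a ^ 2) + 2 * M * (r ^ 2 - 2 * M * r + a ^ 2))) +
        2 * M * r * (2 * (r * (r ^ 2 - 2 * M * r + a ^ 2)) +
          r * (r ^ 2 - 2 * M * r + a ^ 2) * s +
            (r * (r ^ 2 + a ^ 2) + 2 * M * (r ^ 2 - 2 * M * r + a ^ 2)))) * hw
  have hN := scri_quartic_le (b := a ^ 2) hM (sq_nonneg a) h.sq_lt_sq hr
  set X : ℝ := r ^ 2 - (s ^ 2 * (r ^ 2 + a ^ 2) - 2 * M * r * (1 + s) ^ 2) with hX
  have h2 : 7 / 4 * M ^ 2 * r ^ 4 * D ≤ (r * D) ^ 2 * X := by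
    rw [hid]
    have := mul_le_mul_of_nonneg_left hN hDpos.le
    linarith
  have hDr : D ≤ r ^ 2 := by
    rw [hDeq]; nlinarith [h.sq_lt_sq]
  have hrD : 0 < (r * D) ^ 2 := by positivity
  refine le_of_mul_le_mul_left ?_ hrD
  calc (r * D) ^ 2 * (7 / 4 * M ^ 2) = 7 / 4 * M ^ 2 * r ^ 2 * D * D := by ring
    _ ≤ 7 / 4 * M ^ 2 * r ^ 2 * D * r ^ 2 := mul_le_mul_of_nonneg_left hDr (by positivity)
    _ = 7 / 4 * M ^ 2 * r ^ 4 * D := by ring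
    _ ≤ (r * D) ^ 2 * X := h2

/-- **Every slope between the Kerr–Schild slice and the far leaf is uniformly spacelike**:
`r² − P(c) ≥ M²` for `0 ≤ c ≤ σ♯(r)`, `r > r₊`, with `c = 0` or `r ≥ 2M` (quantitative form
of `Kerr.leafQuadratic_lt_sq`; by convexity `P(c) ≤ max(P(0), P(σ♯)) = max(−2Mr, P(σ♯))`).
[folklore] -/
theorem sq_sub_leafQuadratic_ge {M a r c : ℝ} (h : IsSubextremal M a) (hrp : rPlus M a < r)
    (hc0 : 0 ≤ c) (hcσ : c ≤ scriSlope M a r) (hcase : c = 0 ∨ 2 * M ≤ r) :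
    M ^ 2 ≤ r ^ 2 - (c ^ 2 * (r ^ 2 + a ^ 2) - 2 * M * r * (1 + c) ^ 2) := by
  have hM := h.pos
  have hMr : M < r := h.M_lt_rPlus.trans hrp
  have hr0 : 0 < r := hM.trans hMr
  have hM2 : M ^ 2 ≤ r ^ 2 := by nlinarith
  have hMr0 : 0 ≤ 2 * M * r := by positivity
  rcases hcase with hc | hr
  · subst hc
    nlinarith
  set s := scriSlope M a r with hs
  set D : ℝ := r ^ 2 - 2 * M * r + a ^ 2 with hD
  have hDpos : 0 < D := by
    rw [hD, ← sub_rPlus_mul_sub_rMinus h.sq_lt_sq.le r]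
    exact sub_rPlus_mul_sub_rMinus_pos hrp
  have hPs : 7 / 4 * M ^ 2 ≤ r ^ 2 - (s ^ 2 * D - 4 * M * r * s - 2 * M * r) := by
    have := sq_sub_leafQuadratic_scriSlope_ge h hrp hr
    rw [leafQuadratic_eq] at this
    exact this
  rw [leafQuadratic_eq]
  have h1 : c ^ 2 * D ≤ c * s * D := by
    have : c ^ 2 ≤ c * s := by nlinarith
    exact mul_le_mul_of_nonneg_right this hDpos.le
  by_cases hsgn : s * D - 4 * M * r ≤ 0
  · have h2 : c * (s * D - 4 * M * r) ≤ 0 := mul_nonpos_of_nonneg_of_nonpos hc0 hsgn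
    nlinarith [h1, h2]
  · have hsgn' : 0 < s * D - 4 * M * r := not_le.1 hsgn
    have h2 : c * (s * D - 4 * M * r) ≤ s * (s * D - 4 * M * r) :=
      mul_le_mul_of_nonneg_right hcσ hsgn'.le
    nlinarith [h1, h2]

/-- `Σ ≤ 2‖y‖²` on the exterior slice (`Σ = 2r² − ‖y‖² + a²`, `a² < M² < r² ≤ ‖y‖²`).
[folklore] -/
theorem blSigma_le_two_mul_norm_sq {M a : ℝ} (h : IsSubextremal M a) {y : E3}
    (hy : rPlus M a < radius a (E4.ofTimeSpace 0 y)) : blSigma a y ≤ 2 * ‖y‖ ^ 2 := by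
  have hMr : M < radius a (E4.ofTimeSpace 0 y) := h.M_lt_rPlus.trans hy
  have hr0 : 0 < radius a (E4.ofTimeSpace 0 y) := h.pos.trans hMr
  have hn : radius a (E4.ofTimeSpace 0 y) ≤ ‖y‖ := radius_ofTimeSpace_le_norm a 0 y
  have ha : a ^ 2 < M ^ 2 := h.sq_lt_sq
  unfold blSigma
  nlinarith [h.pos]

/-- `d r` expanded in components: `dr(v) = ∑ᵢ (∇r)ᵢ vᵢ`. [folklore] -/
theorem radiusGrad_apply_sum (a : ℝ) (y v : E3) :
    radiusGrad a y v = ∑ i : Fin 3, radiusGradVec a y i * v i := by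
  rw [radiusGrad_apply]
  simp only [EuclideanSpace.inner_eq_star_dotProduct, star_trivial, dotProduct]
  exact Finset.sum_congr rfl fun i _ ↦ mul_comm _ _


/-! ### The pointwise coercivity of the leaf flux density `T[ψ](V, W)` -/

/-- `c² K ≤ 18` for `0 ≤ c ≤ 3`, `0 ≤ K ≤ 2` (the bound on `|k⃗|² = c²|∇r|²`). [folklore] -/
theorem sq_mul_le_eighteen {c K : ℝ} (hc0 : 0 ≤ c) (hc3 : c ≤ 3) (hK0 : 0 ≤ K) (hK2 : K ≤ 2) :
    c ^ 2 * K ≤ 18 := by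
  have hc9 : c ^ 2 ≤ 9 := by nlinarith
  nlinarith [mul_le_mul hc9 hK2 hK0 (by norm_num)]

/-- `|∇r|² = (r² + a²)/Σ ≤ 2` on the exterior slice (`r² ≤ Σ`, `a² < M² < r²`). [folklore] -/
theorem sq_add_sq_div_blSigma_le_two {M a : ℝ} (h : IsSubextremal M a) {y : E3}
    (hy : rPlus M a < radius a (E4.ofTimeSpace 0 y)) :
    (radius a (E4.ofTimeSpace 0 y) ^ 2 + a ^ 2) / blSigma a y ≤ 2 := by
  have hMr : M < radius a (E4.ofTimeSpace 0 y) := h.M_lt_rPlus.trans hy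
  have hr0 : 0 < radius a (E4.ofTimeSpace 0 y) := h.pos.trans hMr
  have hS := blSigma_pos hr0
  have hSr := sq_le_blSigma hr0
  have ha : a ^ 2 < M ^ 2 := h.sq_lt_sq
  rw [div_le_iff₀ hS]
  nlinarith [h.pos]

/-- `H = Mr/Σ ≤ 1` on the exterior (`Σ ≥ r² > Mr`). [folklore] -/
theorem scalarH_ofTimeSpace_le_one {M a : ℝ} (h : IsSubextremal M a) (t : ℝ) {y : E3}
    (hy : rPlus M a < radius a (E4.ofTimeSpace 0 y)) : scalarH M a (E4.ofTimeSpace t y) ≤ 1 := by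
  have hMr : M < radius a (E4.ofTimeSpace 0 y) := h.M_lt_rPlus.trans hy
  have hr0 : 0 < radius a (E4.ofTimeSpace 0 y) := h.pos.trans hMr
  have hS := blSigma_pos hr0
  have hSr := sq_le_blSigma hr0
  rw [scalarH_ofTimeSpace_eq t hr0, div_le_one hS]
  nlinarith [h.pos]

/-- `γ = 1 − |k⃗|² + 2H(1 + c)² ≤ 33` for `0 ≤ H ≤ 1`, `0 ≤ c ≤ 3`, `|k⃗|² ≥ 0`. [folklore] -/
theorem leafGamma_le {H c K : ℝ} (hH1 : H ≤ 1) (hc0 : 0 ≤ c) (hc3 : c ≤ 3)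
    (hK0 : 0 ≤ K) : 1 - K + 2 * H * (1 + c) ^ 2 ≤ 33 := by
  have h16 : (1 + c) ^ 2 ≤ 16 := by nlinarith
  have := mul_le_mul hH1 h16 (sq_nonneg _) zero_le_one
  nlinarith

/-- `γ Σ = Σ − P(c)`: with `|k⃗|² = c²(r² + a²)/Σ` and `H = Mr/Σ`,
`(1 − |k⃗|² + 2H(1 + c)²) Σ = Σ − (c²(r² + a²) − 2Mr(1 + c)²)`. [folklore] -/
theorem leafGamma_mul_blSigma (c r a M S : ℝ) (hS : S ≠ 0) :
    (1 - c ^ 2 * ((r ^ 2 + a ^ 2) / S) + 2 * (M * r / S) * (1 + c) ^ 2) * S =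
      S - (c ^ 2 * (r ^ 2 + a ^ 2) - 2 * M * r * (1 + c) ^ 2) := by
  field_simp
  ring

/-- The weighted time derivative: `‖y‖⁻² s² ≤ (2/M²) γ s²` when `M² ≤ γ Σ` and `Σ ≤ 2‖y‖²`.
[folklore] -/
theorem inv_norm_sq_mul_le {M n γ s S : ℝ} (hM : 0 < M) (hn : 0 < n) (hγ0 : 0 ≤ γ)
    (hγM : M ^ 2 ≤ γ * S) (hS : S ≤ 2 * n ^ 2) :
    n⁻¹ ^ 2 * s ^ 2 ≤ 2 / M ^ 2 * (γ * s ^ 2) := by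
  have h1 : M ^ 2 ≤ γ * (2 * n ^ 2) := hγM.trans (mul_le_mul_of_nonneg_left hS hγ0)
  have h3 : M ^ 2 * s ^ 2 ≤ γ * (2 * n ^ 2) * s ^ 2 := mul_le_mul_of_nonneg_right h1 (sq_nonneg s)
  have hM2 : 0 < M ^ 2 := by positivity
  have hn2 : 0 < n ^ 2 := by positivity
  calc n⁻¹ ^ 2 * s ^ 2 = (M ^ 2 * s ^ 2) / (M ^ 2 * n ^ 2) := by
        field_simp
    _ ≤ (γ * (2 * n ^ 2) * s ^ 2) / (M ^ 2 * n ^ 2) :=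
        div_le_div_of_nonneg_right h3 (by positivity)
    _ = 2 / M ^ 2 * (γ * s ^ 2) := by
        field_simp

/-- **Coercivity of the energy flux through a radial graph leaf (core form).** For `|a| < M`, at
a point `x = (t, y)` of the exterior `{r > r₊}`, let `hgt` be a height function with radial
differential `dh_y = c · dr`, `0 ≤ c ≤ 3`, such that the slope is uniformly spacelike,
`r² − P(c) ≥ M²` (`P(c) = c²(r² + a²) − 2Mr(1 + c)²`; `Kerr.sq_sub_leafQuadratic_ge`). Then for
every scalar field `ψ`, writing `p_μ = dψ_x(∂_μ)` and `W = −g♯d(t* − hgt)` for the leaf normal,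
`∑_{i=1}^{3} (p_i + c (∇r)_i p_0)² + ‖y‖⁻² p_0² ≤ (876 + 3176/M²) · T[ψ](V, W)(x)`.
(Completing the square in `T[ψ](V, W)`, `leafCoercivity_alg`, with `H = Mr/Σ ≤ 1`, `|ℓ⃗| = 1`,
`k⃗ · ℓ⃗ = c`, `|k⃗|² = c²(r² + a²)/Σ ≤ 18`, `γ Σ = Σ − P(c) ≥ M²`, `Σ ≤ 2‖y‖²`.) DRSR
arXiv:1402.7034, §3.1 (28) (the comparability `∫ J^N_μ n^μ ∼ ‖∂ψ‖²` on spacelike leaves) and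
Moschidis arXiv:1509.08489, Thm. 8.1 (the hyperboloidal energy
`∫(|∇_{h_{τ,N}}φ|²_h + r⁻²|Tφ|²) dh_N`), in quantitative Cartesian form. [cite: DafermosRodnianskiShlapentokhrothman2014, §3.1 (28), §3.3; Moschidis2016 Thm. 8.1] -/
theorem leafCoercivity_pointwise_core [Facts] {M a c H : ℝ} {hgt : E3 → ℝ} (hMa : IsSubextremal M a)
    (ψ : region a (rPlus M a) → ℝ) (t : ℝ) (y : E3)
    (hx : E4.ofTimeSpace t y ∈ region a (rPlus M a))
    (hh : fderiv ℝ hgt y = c • radiusGrad a y) (hH : scalarH M a (E4.ofTimeSpace t y) = H)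
    (hc0 : 0 ≤ c) (hc3 : c ≤ 3)
    (hP : M ^ 2 ≤ radius a (E4.ofTimeSpace 0 y) ^ 2 -
      (c ^ 2 * (radius a (E4.ofTimeSpace 0 y) ^ 2 + a ^ 2) -
        2 * M * radius a (E4.ofTimeSpace 0 y) * (1 + c) ^ 2)) :
    (∑ i : Fin 3, (dcov ψ ⟨E4.ofTimeSpace t y, hx⟩ (E4.basisVector i.succ) +
        (c * radiusGradVec a y i) * dcov ψ ⟨E4.ofTimeSpace t y, hx⟩ (E4.basisVector 0)) ^ 2) +
      ‖y‖⁻¹ ^ 2 * dcov ψ ⟨E4.ofTimeSpace t y, hx⟩ (E4.basisVector 0) ^ 2 ≤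
      (876 + 3176 / M ^ 2) *
        (smoothMetric M a (rPlus M a)).stressEnergy ψ ⟨E4.ofTimeSpace t y, hx⟩
          (timeVector M a (E4.ofTimeSpace t y)) (leafNormal M a hgt ⟨E4.ofTimeSpace t y, hx⟩) := by
  have hxr : rPlus M a < radius a (E4.ofTimeSpace 0 y) := by
    rw [← radius_ofTimeSpace a t y]; exact lt_radius_of_mem_region hx
  have hM := hMa.pos
  have hr0 : 0 < radius a (E4.ofTimeSpace 0 y) := hMa.rPlus_pos.trans hxr
  have hxpos : 0 < radius a (E4.ofTimeSpace t y) := radius_pos_of_mem_region hx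
  have hS := blSigma_pos hr0
  have hSr := sq_le_blSigma hr0
  -- `H ∈ [0, 1]`
  have hH0 : 0 ≤ H := hH ▸ scalarH_nonneg hM.le a _
  have hH1 : H ≤ 1 := hH ▸ scalarH_ofTimeSpace_le_one hMa t hxr
  have hHeq : H = M * radius a (E4.ofTimeSpace 0 y) / blSigma a y :=
    hH ▸ scalarH_ofTimeSpace_eq t hr0
  -- `|ℓ⃗| = 1`
  have hl : nullCovectorFun a (E4.ofTimeSpace t y) 1 ^ 2 + nullCovectorFun a (E4.ofTimeSpace t y) 2 ^ 2 + nullCovectorFun a (E4.ofTimeSpace t y) 3 ^ 2 = 1 := sum_sq_nullCovectorFun hxpos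
  -- `k⃗ · ℓ⃗ = c` (`ℓ⃗ · ∇r = 1`)
  have hkl : (c * radiusGradVec a y 0) * nullCovectorFun a (E4.ofTimeSpace t y) 1 + (c * radiusGradVec a y 1) * nullCovectorFun a (E4.ofTimeSpace t y) 2 + (c * radiusGradVec a y 2) * nullCovectorFun a (E4.ofTimeSpace t y) 3 = c := by
    have h1 := radiusGrad_nullSpatial t hr0
    rw [radiusGrad_apply_sum, Fin.sum_univ_three] at h1
    simp only [nullSpatial_apply, Fin.succ_zero_eq_one, Fin.succ_one_eq_two,
      fin_succ_two_eq_three] at h1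
    linear_combination c * h1
  -- `|k⃗|² = c²(r² + a²)/Σ ≤ 18`
  have hK2 : ((c * radiusGradVec a y 0) ^ 2 + (c * radiusGradVec a y 1) ^ 2 + (c * radiusGradVec a y 2) ^ 2) =
      c ^ 2 * ((radius a (E4.ofTimeSpace 0 y) ^ 2 + a ^ 2) / blSigma a y) := by
    have h1 := inner_radiusGradVec_self hr0
    rw [real_inner_self_eq_norm_sq, E3.norm_sq] at h1
    rw [← h1]
    ring
  have hK18 : ((c * radiusGradVec a y 0) ^ 2 + (c * radiusGradVec a y 1) ^ 2 + (c * radiusGradVec a y 2) ^ 2) ≤ 18 := by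
    rw [hK2]
    exact sq_mul_le_eighteen hc0 hc3 (by positivity) (sq_add_sq_div_blSigma_le_two hMa hxr)
  -- `γ Σ = Σ − P(c) ≥ M²`, `0 ≤ γ ≤ 33`
  have hγM : M ^ 2 ≤ (1 - ((c * radiusGradVec a y 0) ^ 2 + (c * radiusGradVec a y 1) ^ 2 + (c * radiusGradVec a y 2) ^ 2) + 2 * H * (1 + c) ^ 2) * blSigma a y := by
    rw [hK2, hHeq, leafGamma_mul_blSigma _ _ _ _ _ hS.ne']
    linarith
  have hγ0 : 0 ≤ (1 - ((c * radiusGradVec a y 0) ^ 2 + (c * radiusGradVec a y 1) ^ 2 + (c * radiusGradVec a y 2) ^ 2) + 2 * H * (1 + c) ^ 2) := by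
    refine le_of_mul_le_mul_right ?_ hS
    rw [zero_mul]
    exact (sq_nonneg M).trans hγM
  have hγ33 : (1 - ((c * radiusGradVec a y 0) ^ 2 + (c * radiusGradVec a y 1) ^ 2 + (c * radiusGradVec a y 2) ^ 2) + 2 * H * (1 + c) ^ 2) ≤ 33 :=
    leafGamma_le hH1 hc0 hc3 (by positivity)
  -- the flux density in components
  have hpl : dcov ψ ⟨E4.ofTimeSpace t y, hx⟩ (nullVector a (E4.ofTimeSpace t y)) = -dcov ψ ⟨E4.ofTimeSpace t y, hx⟩ (E4.basisVector 0) + (nullCovectorFun a (E4.ofTimeSpace t y) 1 * dcov ψ ⟨E4.ofTimeSpace t y, hx⟩ (E4.basisVector 1) + nullCovectorFun a (E4.ofTimeSpace t y) 2 * dcov ψ ⟨E4.ofTimeSpace t y, hx⟩ (E4.basisVector 2) + nullCovectorFun a (E4.ofTimeSpace t y) 3 * dcov ψ ⟨E4.ofTimeSpace t y, hx⟩ (E4.basisVector 3)) := by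
    rw [E4.linearMap_apply_eq_sum, Fin.sum_univ_four]
    simp only [nullVector_apply_zero, nullVector_apply_one, nullVector_apply_two,
      nullVector_apply_three]
    ring
  have hpV : dcov ψ ⟨E4.ofTimeSpace t y, hx⟩ (timeVector M a (E4.ofTimeSpace t y)) =
      dcov ψ ⟨E4.ofTimeSpace t y, hx⟩ (E4.basisVector 0) - 2 * H * dcov ψ ⟨E4.ofTimeSpace t y, hx⟩ (nullVector a (E4.ofTimeSpace t y)) := by
    simp only [timeVector, map_sub, map_smul, smul_eq_mul, hH]
  have hν0 : leafConormal hgt (E4.ofTimeSpace t y) (E4.basisVector 0) = 1 := by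
    rw [leafConormal_apply_of_radial hh]
    simp [E4.spatial_basisVector_zero]
  have hν1 : leafConormal hgt (E4.ofTimeSpace t y) (E4.basisVector 1) = -(c * radiusGradVec a y 0) := by
    rw [leafConormal_apply_of_radial hh, E4.spatial_basisVector_one, radiusGrad_single]
    simp
  have hν2 : leafConormal hgt (E4.ofTimeSpace t y) (E4.basisVector 2) = -(c * radiusGradVec a y 1) := by
    rw [leafConormal_apply_of_radial hh, E4.spatial_basisVector_two, radiusGrad_single]
    simp
  have hν3 : leafConormal hgt (E4.ofTimeSpace t y) (E4.basisVector 3) = -(c * radiusGradVec a y 2) := by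
    rw [leafConormal_apply_of_radial hh, E4.spatial_basisVector_three, radiusGrad_single]
    simp
  have hνl : leafConormal hgt (E4.ofTimeSpace t y) (nullVector a (E4.ofTimeSpace t y)) = -(1 + c) :=
    leafConormal_nullVector_of_radial hh hr0
  have hνV : leafConormal hgt (E4.ofTimeSpace t y) (timeVector M a (E4.ofTimeSpace t y)) = 1 + 2 * H * (1 + c) := by
    rw [leafConormal_timeVector_of_radial hh hr0, hH]
  have hW : leafNormal M a hgt ⟨E4.ofTimeSpace t y, hx⟩ = -coSharp M a (E4.ofTimeSpace t y) (leafConormal hgt (E4.ofTimeSpace t y)) := by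
    rw [leafNormal, sharp_smoothMetric]
    rfl
  have hpW : dcov ψ ⟨E4.ofTimeSpace t y, hx⟩ (leafNormal M a hgt ⟨E4.ofTimeSpace t y, hx⟩) =
      -((-dcov ψ ⟨E4.ofTimeSpace t y, hx⟩ (E4.basisVector 0) - ((c * radiusGradVec a y 0) * dcov ψ ⟨E4.ofTimeSpace t y, hx⟩ (E4.basisVector 1) + (c * radiusGradVec a y 1) * dcov ψ ⟨E4.ofTimeSpace t y, hx⟩ (E4.basisVector 2) + (c * radiusGradVec a y 2) * dcov ψ ⟨E4.ofTimeSpace t y, hx⟩ (E4.basisVector 3))) -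
        2 * H * (-(1 + c)) * dcov ψ ⟨E4.ofTimeSpace t y, hx⟩ (nullVector a (E4.ofTimeSpace t y))) := by
    rw [hW, map_neg, coSharp, map_sub, map_smul, smul_eq_mul, hνl, hH,
      E4.linearMap_apply_eq_sum _ (etaSharp _), Fin.sum_univ_four]
    simp only [etaSharp_apply_zero, etaSharp_apply_one, etaSharp_apply_two, etaSharp_apply_three,
      hν0, hν1, hν2, hν3]
    ring
  have hVW : (smoothMetric M a (rPlus M a)).val ⟨E4.ofTimeSpace t y, hx⟩ (timeVector M a (E4.ofTimeSpace t y))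
      (leafNormal M a hgt ⟨E4.ofTimeSpace t y, hx⟩) = -(1 + 2 * H * (1 + c)) := by
    rw [smoothMetric_val, ← hνV]
    exact bilin_timeVector_leafNormal M a hgt ⟨E4.ofTimeSpace t y, hx⟩
  have hgrad : (smoothMetric M a (rPlus M a)).gradSq ψ ⟨E4.ofTimeSpace t y, hx⟩ =
      -dcov ψ ⟨E4.ofTimeSpace t y, hx⟩ (E4.basisVector 0) ^ 2 + (dcov ψ ⟨E4.ofTimeSpace t y, hx⟩ (E4.basisVector 1) ^ 2 + dcov ψ ⟨E4.ofTimeSpace t y, hx⟩ (E4.basisVector 2) ^ 2 + dcov ψ ⟨E4.ofTimeSpace t y, hx⟩ (E4.basisVector 3) ^ 2) -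
        2 * H * dcov ψ ⟨E4.ofTimeSpace t y, hx⟩ (nullVector a (E4.ofTimeSpace t y)) ^ 2 := by
    rw [PseudoRiemannianMetric.gradSq, PseudoRiemannianMetric.innerDual, sharp_smoothMetric]
    change dcov ψ ⟨E4.ofTimeSpace t y, hx⟩ (coSharp M a (E4.ofTimeSpace t y) (dcov ψ ⟨E4.ofTimeSpace t y, hx⟩)) = _
    simp only [coSharp, map_sub, map_smul, smul_eq_mul, apply_etaSharp, hH]
    ring
  have hT : (smoothMetric M a (rPlus M a)).stressEnergy ψ ⟨E4.ofTimeSpace t y, hx⟩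
          (timeVector M a (E4.ofTimeSpace t y)) (leafNormal M a hgt ⟨E4.ofTimeSpace t y, hx⟩) =
      -((1 + 2 * H) * dcov ψ ⟨E4.ofTimeSpace t y, hx⟩ (E4.basisVector 0) - 2 * H * (nullCovectorFun a (E4.ofTimeSpace t y) 1 * dcov ψ ⟨E4.ofTimeSpace t y, hx⟩ (E4.basisVector 1) + nullCovectorFun a (E4.ofTimeSpace t y) 2 * dcov ψ ⟨E4.ofTimeSpace t y, hx⟩ (E4.basisVector 2) + nullCovectorFun a (E4.ofTimeSpace t y) 3 * dcov ψ ⟨E4.ofTimeSpace t y, hx⟩ (E4.basisVector 3))) *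
            (-dcov ψ ⟨E4.ofTimeSpace t y, hx⟩ (E4.basisVector 0) - ((c * radiusGradVec a y 0) * dcov ψ ⟨E4.ofTimeSpace t y, hx⟩ (E4.basisVector 1) + (c * radiusGradVec a y 1) * dcov ψ ⟨E4.ofTimeSpace t y, hx⟩ (E4.basisVector 2) + (c * radiusGradVec a y 2) * dcov ψ ⟨E4.ofTimeSpace t y, hx⟩ (E4.basisVector 3)) -
              2 * H * (1 + c) * (dcov ψ ⟨E4.ofTimeSpace t y, hx⟩ (E4.basisVector 0) - (nullCovectorFun a (E4.ofTimeSpace t y) 1 * dcov ψ ⟨E4.ofTimeSpace t y, hx⟩ (E4.basisVector 1) + nullCovectorFun a (E4.ofTimeSpace t y) 2 * dcov ψ ⟨E4.ofTimeSpace t y, hx⟩ (E4.basisVector 2) + nullCovectorFun a (E4.ofTimeSpace t y) 3 * dcov ψ ⟨E4.ofTimeSpace t y, hx⟩ (E4.basisVector 3)))) +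
          (1 + 2 * H * (1 + c)) / 2 *
            (-dcov ψ ⟨E4.ofTimeSpace t y, hx⟩ (E4.basisVector 0) ^ 2 + (dcov ψ ⟨E4.ofTimeSpace t y, hx⟩ (E4.basisVector 1) ^ 2 + dcov ψ ⟨E4.ofTimeSpace t y, hx⟩ (E4.basisVector 2) ^ 2 + dcov ψ ⟨E4.ofTimeSpace t y, hx⟩ (E4.basisVector 3) ^ 2) -
              2 * H * (-dcov ψ ⟨E4.ofTimeSpace t y, hx⟩ (E4.basisVector 0) + (nullCovectorFun a (E4.ofTimeSpace t y) 1 * dcov ψ ⟨E4.ofTimeSpace t y, hx⟩ (E4.basisVector 1) + nullCovectorFun a (E4.ofTimeSpace t y) 2 * dcov ψ ⟨E4.ofTimeSpace t y, hx⟩ (E4.basisVector 2) + nullCovectorFun a (E4.ofTimeSpace t y) 3 * dcov ψ ⟨E4.ofTimeSpace t y, hx⟩ (E4.basisVector 3))) ^ 2) := by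
    rw [PseudoRiemannianMetric.stressEnergy_apply]
    simp only [mvfderiv_apply_eq_dcov]
    rw [hpV, hpW, hgrad, hVW, hpl]
    ring
  -- the algebra
  obtain ⟨hq, hs⟩ := leafCoercivity_alg H (dcov ψ ⟨E4.ofTimeSpace t y, hx⟩ (E4.basisVector 0)) (dcov ψ ⟨E4.ofTimeSpace t y, hx⟩ (E4.basisVector 1)) (dcov ψ ⟨E4.ofTimeSpace t y, hx⟩ (E4.basisVector 2)) (dcov ψ ⟨E4.ofTimeSpace t y, hx⟩ (E4.basisVector 3)) (c * radiusGradVec a y 0) (c * radiusGradVec a y 1) (c * radiusGradVec a y 2)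
    (nullCovectorFun a (E4.ofTimeSpace t y) 1) (nullCovectorFun a (E4.ofTimeSpace t y) 2) (nullCovectorFun a (E4.ofTimeSpace t y) 3) c hH0 hH1 hl hK18 hkl hc0 hγ0 hγ33
  rw [← hT] at hq hs
  -- `‖y‖⁻² s² ≤ (2/M²) γ s² ≤ (3176/M²) T`
  have hy0 : 0 < ‖y‖ := hr0.trans_le (radius_ofTimeSpace_le_norm a 0 y)
  have hys := inv_norm_sq_mul_le (s := dcov ψ ⟨E4.ofTimeSpace t y, hx⟩ (E4.basisVector 0)) hM hy0 hγ0 hγM (blSigma_le_two_mul_norm_sq hMa hxr)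
  have hs' := mul_le_mul_of_nonneg_left hs (by positivity : (0 : ℝ) ≤ 2 / M ^ 2)
  have hfin := add_le_add hq (hys.trans hs')
  rw [Fin.sum_univ_three]
  simp only [Fin.succ_zero_eq_one, Fin.succ_one_eq_two, fin_succ_two_eq_three]
  linear_combination hfin

/-- **Coercivity of the flux density through the leaves of a cut-off graph foliation.** For
`|a| < M`, a far slope `σ` continuous on `(r₊, ∞)` with `0 ≤ σ ≤ σ♯ = scriSlope M a` there, and
`R₁ ≥ 4M`, at every exterior point `x = (t, y)` and for every scalar field `ψ`, with
`h = cutoffHeight σ a R₁`, `p_μ = dψ_x(∂_μ)` and `W = −g♯d(t* − h)`: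
`∑_{i=1}^{3} (p_i + ∂_ih(y) p_0)² + ‖y‖⁻² p_0² ≤ (876 + 3176/M²) · T[ψ](V, W)(x)` — the slope
`c = χ((r − R₁)/R₁) σ(r) ∈ [0, 3)` of the leaf (`Kerr.scriSlope_lt_three`) is uniformly spacelike,
`r² − P(c) ≥ M²` (`Kerr.sq_sub_leafQuadratic_ge`), and `leafCoercivity_pointwise_core` applies.
DRSR arXiv:1402.7034, §3.1 (28), §3.3; Moschidis arXiv:1509.08489, Thm. 8.1. [cite: DafermosRodnianskiShlapentokhrothman2014, §3.1 (28), §3.3; Moschidis2016 Thm. 8.1] -/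
theorem leafCoercivity_pointwise [Facts] {M a R₁ : ℝ} {σ : ℝ → ℝ} (hMa : IsSubextremal M a)
    (hσc : ContinuousOn σ (Ioi (rPlus M a))) (hσ0 : ∀ s, rPlus M a < s → 0 ≤ σ s)
    (hσ1 : ∀ s, rPlus M a < s → σ s ≤ scriSlope M a s) (hR : 4 * M ≤ R₁)
    (ψ : region a (rPlus M a) → ℝ) (t : ℝ) (y : E3)
    (hx : E4.ofTimeSpace t y ∈ region a (rPlus M a)) :
    (∑ i : Fin 3, (dcov ψ ⟨E4.ofTimeSpace t y, hx⟩ (E4.basisVector i.succ) +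
        fderiv ℝ (cutoffHeight σ a R₁) y (EuclideanSpace.single i 1) *
          dcov ψ ⟨E4.ofTimeSpace t y, hx⟩ (E4.basisVector 0)) ^ 2) +
      ‖y‖⁻¹ ^ 2 * (dcov ψ ⟨E4.ofTimeSpace t y, hx⟩ (E4.basisVector 0)) ^ 2 ≤
      (876 + 3176 / M ^ 2) *
        (smoothMetric M a (rPlus M a)).stressEnergy ψ ⟨E4.ofTimeSpace t y, hx⟩
          (timeVector M a (E4.ofTimeSpace t y))
          (leafNormal M a (cutoffHeight σ a R₁) ⟨E4.ofTimeSpace t y, hx⟩) := by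
  have hxr : rPlus M a < radius a (E4.ofTimeSpace 0 y) := by
    rw [← radius_ofTimeSpace a t y]; exact lt_radius_of_mem_region hx
  have hM := hMa.pos
  have hrp0 := hMa.rPlus_pos
  have hR0 : 0 < R₁ := by linarith
  have hRp : rPlus M a < R₁ := (rPlus_le_two_mul hM.le).trans_lt (by linarith)
  -- the slope `c` of the leaf at `y`: `dh_y = c · dr`
  obtain ⟨c, hc⟩ : ∃ c : ℝ, Real.smoothTransition ((radius a (E4.ofTimeSpace 0 y) - R₁) / R₁) *
      σ (radius a (E4.ofTimeSpace 0 y)) = c := ⟨_, rfl⟩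
  have hh : fderiv ℝ (cutoffHeight σ a R₁) y = c • radiusGrad a y := by
    rw [← hc]; exact (hasFDerivAt_cutoffHeight hrp0.le hσc hRp hxr).fderiv
  have hχ0 := Real.smoothTransition.nonneg ((radius a (E4.ofTimeSpace 0 y) - R₁) / R₁)
  have hχ1 := Real.smoothTransition.le_one ((radius a (E4.ofTimeSpace 0 y) - R₁) / R₁)
  have hσr := hσ0 _ hxr
  have hc0 : 0 ≤ c := hc ▸ mul_nonneg hχ0 hσr
  have hcσ : c ≤ scriSlope M a (radius a (E4.ofTimeSpace 0 y)) := by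
    rw [← hc]
    calc _ ≤ 1 * σ (radius a (E4.ofTimeSpace 0 y)) := mul_le_mul_of_nonneg_right hχ1 hσr
      _ ≤ _ := by rw [one_mul]; exact hσ1 _ hxr
  have hcase : c = 0 ∨ 2 * M ≤ radius a (E4.ofTimeSpace 0 y) := by
    by_cases hrR : radius a (E4.ofTimeSpace 0 y) ≤ R₁
    · left
      have : (radius a (E4.ofTimeSpace 0 y) - R₁) / R₁ ≤ 0 :=
        div_nonpos_of_nonpos_of_nonneg (by linarith) hR0.le
      rw [← hc, Real.smoothTransition.zero_of_nonpos this, zero_mul]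
    · right
      linarith [not_le.1 hrR]
  have hc3 : c ≤ 3 := by
    by_cases hrR : radius a (E4.ofTimeSpace 0 y) ≤ R₁
    · have : (radius a (E4.ofTimeSpace 0 y) - R₁) / R₁ ≤ 0 :=
        div_nonpos_of_nonpos_of_nonneg (by linarith) hR0.le
      rw [← hc, Real.smoothTransition.zero_of_nonpos this, zero_mul]
      norm_num
    · have h4 : 4 * M ≤ radius a (E4.ofTimeSpace 0 y) := by linarith [not_le.1 hrR]
      exact hcσ.trans (scriSlope_lt_three hMa h4).le
  have hP := sq_sub_leafQuadratic_ge hMa hxr hc0 hcσ hcase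
  have hk : ∀ i : Fin 3,
      fderiv ℝ (cutoffHeight σ a R₁) y (EuclideanSpace.single i 1) = c * radiusGradVec a y i := by
    intro i
    rw [hh]
    exact congrArg (c * ·) (radiusGrad_single a y i)
  simp_rw [hk]
  exact leafCoercivity_pointwise_core hMa ψ t y hx hh rfl hc0 hc3 hP

/-! ### The leaf functions: chain rule along the graph -/

/-- **Chain rule for the leaf functions**: at `y ∈ S`, with `p = (τ + h(y), y)` the leaf point,
`∂_{y_i} Ψ_τ(y) = dψ_p(∂_{i+1}) + ∂_ih(y) dψ_p(∂₀)` (`Ψ_τ = ψ̃ ∘ (y ↦ (τ + h y, y))`,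
`Kerr.fderiv_comp_graphMap`, and `dψ_p = Dψ̃(p)` on the chart, `mvfderiv_eq_fderiv_extend`).
[folklore] -/
theorem fderiv_leafFun_apply_single {M a : ℝ} {hgt : E3 → ℝ} {ψ : region a (rPlus M a) → ℝ}
    (hψ : ContMDiff 𝓘(ℝ, E4) 𝓘(ℝ, ℝ) ∞ ψ) (τ : ℝ) {y : E3}
    (hy : y ∈ (slice a (rPlus M a) : Set E3)) (hh : DifferentiableAt ℝ hgt y) (i : Fin 3) :
    fderiv ℝ (leafFun M a hgt ψ τ) y (EuclideanSpace.single i 1) =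
      dcov ψ ⟨leafPoint hgt τ y, (ofTimeSpace_mem_region_iff.2 hy : leafPoint hgt τ y ∈ _)⟩
          (E4.basisVector i.succ) +
        fderiv ℝ hgt y (EuclideanSpace.single i 1) *
          dcov ψ ⟨leafPoint hgt τ y, (ofTimeSpace_mem_region_iff.2 hy : leafPoint hgt τ y ∈ _)⟩
            (E4.basisVector 0) := by
  have hmem : leafPoint hgt τ y ∈ region a (rPlus M a) := ofTimeSpace_mem_region_iff.2 hy
  have hJ : DifferentiableAt ℝ (Function.extend Subtype.val ψ 0) (E4.ofTimeSpace (τ + hgt y) y) :=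
    (contDiffAt_extend hψ ⟨_, hmem⟩).differentiableAt (by simp)
  have hcomp : leafFun M a hgt ψ τ =
      fun y ↦ Function.extend Subtype.val ψ 0 (E4.ofTimeSpace (τ + hgt y) y) := rfl
  have e : ∀ v : E4, fderiv ℝ (Function.extend Subtype.val ψ 0) (E4.ofTimeSpace (τ + hgt y) y) v =
      dcov ψ ⟨leafPoint hgt τ y, hmem⟩ v :=
    fun v ↦ (mvfderiv_eq_fderiv_extend _ ψ ⟨_, hmem⟩ v).symm
  rw [hcomp, fderiv_comp_graphMap hh τ hJ i, partialE3, e, e, add_comm]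

/-- Along the leaf, the leaf function of `Tψ` is the time derivative at the leaf point:
`(TΨ)_τ(y) = dψ_p(∂₀)`, `p = (τ + h(y), y)`, for `y ∈ S`. [folklore] -/
theorem leafFun_timeDeriv_apply {M a : ℝ} (hgt : E3 → ℝ) (ψ : region a (rPlus M a) → ℝ) (τ : ℝ)
    {y : E3} (hy : y ∈ (slice a (rPlus M a) : Set E3)) :
    leafFun M a hgt (timeDeriv ψ) τ y =
      dcov ψ ⟨leafPoint hgt τ y, (ofTimeSpace_mem_region_iff.2 hy : leafPoint hgt τ y ∈ _)⟩
        (E4.basisVector 0) := by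
  rw [leafFun_apply_of_mem hgt _ τ (ofTimeSpace_mem_region_iff.2 hy), timeDeriv,
    ← mvfderiv_eq_fderiv_extend]
  rfl

/-! ### Integration over the leaf: `leafGradEnergy ≤ C · leafFlux` -/

/-- **The first-order Cartesian leaf energy is controlled by the energy flux through the leaf**:
for `|a| < M`, a far slope `σ` as in `leafCoercivity_pointwise`, `R₁ ≥ 4M` and a smooth `ψ` on the
exterior chart, `A(τ) = ∫_S (‖DΨ_τ‖² + ‖y‖⁻²((TΨ)_τ)²) dy ≤ (876 + 3176/M²) ∫_{Σ̃_τ(h)} J^V_μ n^μ dσ`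
(`h = cutoffHeight σ a R₁`; `Kerr.leafGradEnergy`, `Kerr.leafFlux`): integrate
`leafCoercivity_pointwise` over `S = {r(0, y) > r₊}`, where the leaf point `(τ + h(y), y)` lies in
the exterior and `‖DΨ_τ(y)‖² = ∑ᵢ (∂_{y_i}Ψ_τ)²`. This is the comparability
`∫_{Σ̃_τ} J^N_μ n^μ ≳ ∫_{t̄=τ}(|∇_{h_{τ,N}}φ|²_h + r⁻²|Tφ|²) dh_N` between DRSR's flux (Cor. 3.1,
first estimate) and Moschidis' hyperboloidal energy (Thm. 8.1), for the Cartesian rendering of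
`KerrPointwiseDecayHierarchy.lean`. [cite: DafermosRodnianskiShlapentokhrothman2014, §3.1 (28), §3.3 Cor. 3.1; Moschidis2016 Thm. 8.1] -/
theorem leafGradEnergy_le_leafFlux [Facts] {M a R₁ : ℝ} {σ : ℝ → ℝ} (hMa : IsSubextremal M a)
    (hσc : ContinuousOn σ (Ioi (rPlus M a))) (hσ0 : ∀ s, rPlus M a < s → 0 ≤ σ s)
    (hσ1 : ∀ s, rPlus M a < s → σ s ≤ scriSlope M a s) (hR : 4 * M ≤ R₁)
    {ψ : region a (rPlus M a) → ℝ} (hψ : ContMDiff 𝓘(ℝ, E4) 𝓘(ℝ, ℝ) ∞ ψ) (τ : ℝ) :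
    leafGradEnergy M a (cutoffHeight σ a R₁) ψ τ ≤
      ENNReal.ofReal (876 + 3176 / M ^ 2) * leafFlux M a (cutoffHeight σ a R₁) ψ τ := by
  have hM := hMa.pos
  have hrp0 := hMa.rPlus_pos
  have hRp : rPlus M a < R₁ := (rPlus_le_two_mul hM.le).trans_lt (by linarith)
  have hC0 : 0 ≤ 876 + 3176 / M ^ 2 := by positivity
  have hS : MeasurableSet (slice a (rPlus M a) : Set E3) := (slice a (rPlus M a)).isOpen.measurableSet
  unfold leafGradEnergy leafFlux
  calc (∫⁻ y in (slice a (rPlus M a) : Set E3),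
        ENNReal.ofReal (‖fderiv ℝ (leafFun M a (cutoffHeight σ a R₁) ψ τ) y‖ ^ 2 +
          ‖y‖⁻¹ ^ 2 * (leafFun M a (cutoffHeight σ a R₁) (timeDeriv ψ) τ y) ^ 2))
      ≤ ∫⁻ y in (slice a (rPlus M a) : Set E3),
          ENNReal.ofReal (876 + 3176 / M ^ 2) * leafFluxDensity M a (cutoffHeight σ a R₁) ψ τ y := by
        refine setLIntegral_mono' hS fun y hy ↦ ?_
        have hyr : rPlus M a < radius a (E4.ofTimeSpace 0 y) := by
          have := (mem_slice.1 hy); rw [max_eq_left hrp0.le] at this; exact this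
        have hmem : leafPoint (cutoffHeight σ a R₁) τ y ∈ region a (rPlus M a) :=
          ofTimeSpace_mem_region_iff.2 hy
        have hdiff : DifferentiableAt ℝ (cutoffHeight σ a R₁) y :=
          (hasFDerivAt_cutoffHeight hrp0.le hσc hRp hyr).differentiableAt
        have hpt := leafCoercivity_pointwise hMa hσc hσ0 hσ1 hR ψ (τ + cutoffHeight σ a R₁ y) y hmem
        rw [leafFluxDensity_of_mem _ ψ τ hmem, ← ENNReal.ofReal_mul hC0]
        refine ENNReal.ofReal_le_ofReal ?_
        rw [norm_sq_eq_sum_sq_apply_single, leafFun_timeDeriv_apply _ ψ τ hy]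
        simp_rw [fderiv_leafFun_apply_single hψ τ hy hdiff]
        exact hpt
    _ ≤ ∫⁻ y, ENNReal.ofReal (876 + 3176 / M ^ 2) * leafFluxDensity M a (cutoffHeight σ a R₁) ψ τ y :=
        setLIntegral_le_lintegral _ _
    _ = ENNReal.ofReal (876 + 3176 / M ^ 2) *
          ∫⁻ y, leafFluxDensity M a (cutoffHeight σ a R₁) ψ τ y :=
        lintegral_const_mul' _ _ ENNReal.ofReal_ne_top

/-- The same for the foliation `Σ̃_τ(h♯_{R₁})` terminating at `𝓘⁺` (`σ = σ♯ = scriSlope M a`,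
`h♯_{R₁} = Kerr.scriHeight M a R₁`), `R₁ ≥ 4M`:
`leafGradEnergy … ψ τ ≤ (876 + 3176/M²) · leafFlux … ψ τ`. DRSR arXiv:1402.7034, §3.3;
Moschidis arXiv:1509.08489, Thm. 8.1. [cite: DafermosRodnianskiShlapentokhrothman2014, §3.3 Cor. 3.1; Moschidis2016 Thm. 8.1] -/
theorem leafGradEnergy_scriHeight_le_leafFlux [Facts] {M a R₁ : ℝ} (hMa : IsSubextremal M a)
    (hR : 4 * M ≤ R₁) {ψ : region a (rPlus M a) → ℝ} (hψ : ContMDiff 𝓘(ℝ, E4) 𝓘(ℝ, ℝ) ∞ ψ)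
    (τ : ℝ) :
    leafGradEnergy M a (scriHeight M a R₁) ψ τ ≤
      ENNReal.ofReal (876 + 3176 / M ^ 2) * leafFlux M a (scriHeight M a R₁) ψ τ :=
  leafGradEnergy_le_leafFlux hMa (contDiffOn_scriSlope hMa).continuousOn
    (fun _ hs ↦ (scriSlope_pos hMa hs).le) (fun _ _ ↦ le_rfl) hR hψ τ

/-! ### (D1) from DRSR Corollary 3.1, first estimate; the pointwise decay from the flux decay -/

/-- **Hypothesis (D1) of the assembly from DRSR Corollary 3.1, first estimate.** The named fact
`Kerr.drsr_corollary_3_1_scri_flux_decay` (`∫_{Σ̃_τ(h♯_{R₁})} J^V_μ[ψ] n^μ ≤ C τ⁻²`, `τ ≥ 1`,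
`KerrHyperboloidalFlux.lean`) implies the decay `A(τ) = leafGradEnergy … ψ τ ≤ C' τ⁻²` of the
first-order Cartesian leaf energy of `KerrPointwiseDecayHierarchy.lean`, hypothesis (D1) of
`Kerr.drsr_corollary_3_1_scri_pointwise_decay_of_leafEnergy_decay`, with threshold radius
`max(R₀, 4M)` and `C' = (876 + 3176/M²) C` (`leafGradEnergy_scriHeight_le_leafFlux`). In the
source this is the step "`∫_{Σ̃_τ} J^N n ≤ C E τ⁻²`, hence (Thm. 8.1)
`∫_{t̄=τ}(|∇_{h_{τ,N}}φ|²_h + r⁻²|Tφ|²) dh_N ≲ τ⁻²`" of Moschidis' derivation of DRSR Cor. 3.1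
(arXiv:1509.08489, §1.3.3 and §9.4). [cite: DafermosRodnianskiShlapentokhrothman2014, §3.3 Cor. 3.1 (first estimate); Moschidis2016 Thm. 8.1, §9.4] -/
theorem leafGradEnergy_decay_of_flux_decay (hF : drsr_corollary_3_1_scri_flux_decay) :
    ∀ [Facts] [SliceFacts] (M a : ℝ), IsSubextremal M a →
      ∃ R₀ : ℝ, rPlus M a < R₀ ∧ ∀ R₁ : ℝ, R₀ ≤ R₁ →
        ∀ ψ : region a (rPlus M a) → ℝ, Literature.Geometry.Lorentzian.IsAdmissibleKerrWave M a ψ →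
          HasBallData M a R₁ ψ →
            ∃ C : ℝ, ∀ τ : ℝ, 1 ≤ τ →
              leafGradEnergy M a (scriHeight M a R₁) ψ τ ≤ ENNReal.ofReal (C * τ ^ (-2 : ℝ)) := by
  intro _ _ M a hMa
  obtain ⟨R₀, hR₀, hF'⟩ := hF M a hMa
  have hM := hMa.pos
  refine ⟨max R₀ (4 * M), ?_, fun R₁ hR₁ ψ hψ hball ↦ ?_⟩
  · exact lt_max_of_lt_right ((rPlus_le_two_mul hM.le).trans_lt (by linarith))
  have hR₀₁ : R₀ ≤ R₁ := (le_max_left _ _).trans hR₁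
  have h4 : 4 * M ≤ R₁ := (le_max_right _ _).trans hR₁
  obtain ⟨C, hC, hdec⟩ := hF' R₁ hR₀₁ ψ hψ hball
  refine ⟨(876 + 3176 / M ^ 2) * C.toReal, fun τ hτ ↦ ?_⟩
  have hC0 : 0 ≤ 876 + 3176 / M ^ 2 := by positivity
  calc leafGradEnergy M a (scriHeight M a R₁) ψ τ
      ≤ ENNReal.ofReal (876 + 3176 / M ^ 2) * leafFlux M a (scriHeight M a R₁) ψ τ :=
        leafGradEnergy_scriHeight_le_leafFlux hMa h4 hψ.contMDiff τ
    _ ≤ ENNReal.ofReal (876 + 3176 / M ^ 2) * (C * ENNReal.ofReal (τ ^ (-2 : ℝ))) :=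
        mul_le_mul_of_nonneg_left (hdec τ hτ) zero_le
    _ = ENNReal.ofReal ((876 + 3176 / M ^ 2) * C.toReal * τ ^ (-2 : ℝ)) := by
        rw [← ENNReal.ofReal_toReal hC.ne, ← ENNReal.ofReal_mul ENNReal.toReal_nonneg,
          ← ENNReal.ofReal_mul hC0, ENNReal.toReal_ofReal ENNReal.toReal_nonneg, mul_assoc]

/-- **DRSR Corollary 3.1 (30), leaf form, from the first energy-flux estimate and the
second-order/a-priori inputs (D2)–(D3).** `Kerr.drsr_corollary_3_1_scri_flux_decay` (the named
fact vendoring DRSR Cor. 3.1, first estimate, for `Σ̃_τ(h♯_{R₁})`) together with (D2) (improved decay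
`τ^{-4+2δ}` of the second-order leaf energy: Cor. 3.1, second estimate / Moschidis Thm. 9.1) and
(D3) (a priori `‖y‖|Ψ_τ|, ‖y‖‖DΨ_τ‖ ≤ C₀` on each leaf: Cor. 3.1, third estimate / Thm. 7.1)
imply the leaf form of (30), `sup_{Σ̃_τ(h♯_{R₁}) ∩ {r₊ < r ≤ R}} |ψ| ≤ C τ^{-3/2+δ}`:
`Kerr.drsr_corollary_3_1_scri_pointwise_decay_of_leafEnergy_decay'` (`KerrSliceAgmon.lean`, (GN)
proved there) with (D1) supplied by `leafGradEnergy_decay_of_flux_decay`. DRSR arXiv:1402.7034,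
§3.3; Moschidis arXiv:1509.08489, §9.4. [cite: DafermosRodnianskiShlapentokhrothman2014, §3.3 Cor. 3.1 (30); Moschidis2016 §9.4] -/
theorem drsr_corollary_3_1_scri_pointwise_decay_of_flux_decay
    (hF : drsr_corollary_3_1_scri_flux_decay)
    (hD : ∀ [Facts] [SliceFacts] (M a : ℝ), IsSubextremal M a →
        ∃ R₀ : ℝ, rPlus M a < R₀ ∧ ∀ R₁ : ℝ, R₀ ≤ R₁ →
          ∀ ψ : region a (rPlus M a) → ℝ, Literature.Geometry.Lorentzian.IsAdmissibleKerrWave M a ψ →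
            HasBallData M a R₁ ψ →
              -- (D2) second-order leaf energy, improved decay: Cor. 3.1, second estimate /
              -- Moschidis Thm. 9.1, q = 2
              (∀ δ : ℝ, 0 < δ → ∃ C : ℝ, ∀ τ : ℝ, 1 ≤ τ →
                leafHessEnergy M a (scriHeight M a R₁) ψ τ ≤
                  ENNReal.ofReal (C * τ ^ (-4 + 2 * δ))) ∧
              -- (D3) a priori decay along each leaf: Cor. 3.1, third estimate; radiation field
              (∀ τ : ℝ, 1 ≤ τ → ∃ C₀ : ℝ, ∀ y ∈ (slice a (rPlus M a) : Set E3),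
                ‖y‖ * |leafFun M a (scriHeight M a R₁) ψ τ y| ≤ C₀ ∧
                  ‖y‖ * ‖fderiv ℝ (leafFun M a (scriHeight M a R₁) ψ τ) y‖ ≤ C₀)) :
    ∀ [Facts] [SliceFacts] (M a : ℝ), IsSubextremal M a →
      ∃ R₀ : ℝ, 0 < R₀ ∧ ∀ R₁ : ℝ, R₀ ≤ R₁ →
        ∀ ψ : region a (rPlus M a) → ℝ, Literature.Geometry.Lorentzian.IsAdmissibleKerrWave M a ψ →
          HasBallData M a R₁ ψ → ∀ δ : ℝ, 0 < δ → ∀ R : ℝ, rPlus M a < R →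
            ∃ C : ℝ, ∀ τ : ℝ, 1 ≤ τ →
              ∀ (y : E3) (hy : leafPoint (scriHeight M a R₁) τ y ∈ region a (rPlus M a)),
                radius a (leafPoint (scriHeight M a R₁) τ y) ≤ R →
                  |ψ ⟨leafPoint (scriHeight M a R₁) τ y, hy⟩| ≤ C * τ ^ (-(3 / 2 : ℝ) + δ) := by
  refine drsr_corollary_3_1_scri_pointwise_decay_of_leafEnergy_decay' ?_
  intro _ _ M a hMa
  obtain ⟨R₁', h₁, hD1⟩ := leafGradEnergy_decay_of_flux_decay hF M a hMa
  obtain ⟨R₂, h₂, hD23⟩ := hD M a hMa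
  refine ⟨max R₁' R₂, lt_max_of_lt_left h₁, fun R₁ hR₁ ψ hψ hball ↦ ⟨?_, ?_⟩⟩
  · exact hD1 R₁ ((le_max_left _ _).trans hR₁) ψ hψ hball
  · exact hD23 R₁ ((le_max_right _ _).trans hR₁) ψ hψ hball

/-- **The gr.S24 named fact `Literature.Geometry.Lorentzian.drsr_wave_pointwise_decay_kerr` (DRSR
Cor. 3.1 (30), coordinate form) from DRSR Cor. 3.1, first estimate
(`Kerr.drsr_corollary_3_1_scri_flux_decay`), and the inputs (D2)–(D3)** — the first-order energy
decay (D1) of the assembly of `KerrPointwiseDecayHierarchy.lean`/`KerrSliceAgmon.lean` is now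
supplied by the flux-decay fact through the coercivity of this file, and (GN) is proved; what
remains assumed is (D2) (Moschidis Thm. 9.1, `q = 2`) and (D3) (Thm. 7.1). DRSR arXiv:1402.7034,
§3.3 Cor. 3.1 (30); Moschidis arXiv:1509.08489, §9.4. [cite: DafermosRodnianskiShlapentokhrothman2014, §3.3 Cor. 3.1 (30); Moschidis2016 §9.4] -/
theorem _root_.Literature.Geometry.Lorentzian.drsr_wave_pointwise_decay_kerr_of_flux_decay
    (hF : drsr_corollary_3_1_scri_flux_decay)
    (hD : ∀ [Facts] [SliceFacts] (M a : ℝ), IsSubextremal M a →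
        ∃ R₀ : ℝ, rPlus M a < R₀ ∧ ∀ R₁ : ℝ, R₀ ≤ R₁ →
          ∀ ψ : region a (rPlus M a) → ℝ, Literature.Geometry.Lorentzian.IsAdmissibleKerrWave M a ψ →
            HasBallData M a R₁ ψ →
              -- (D2) second-order leaf energy, improved decay: Cor. 3.1, second estimate /
              -- Moschidis Thm. 9.1, q = 2
              (∀ δ : ℝ, 0 < δ → ∃ C : ℝ, ∀ τ : ℝ, 1 ≤ τ →
                leafHessEnergy M a (scriHeight M a R₁) ψ τ ≤
                  ENNReal.ofReal (C * τ ^ (-4 + 2 * δ))) ∧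
              -- (D3) a priori decay along each leaf: Cor. 3.1, third estimate; radiation field
              (∀ τ : ℝ, 1 ≤ τ → ∃ C₀ : ℝ, ∀ y ∈ (slice a (rPlus M a) : Set E3),
                ‖y‖ * |leafFun M a (scriHeight M a R₁) ψ τ y| ≤ C₀ ∧
                  ‖y‖ * ‖fderiv ℝ (leafFun M a (scriHeight M a R₁) ψ τ) y‖ ≤ C₀)) :
    Literature.Geometry.Lorentzian.drsr_wave_pointwise_decay_kerr := by
  refine Literature.Geometry.Lorentzian.drsr_wave_pointwise_decay_kerr_of_leafEnergy_decay' ?_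
  intro _ _ M a hMa
  obtain ⟨R₁', h₁, hD1⟩ := leafGradEnergy_decay_of_flux_decay hF M a hMa
  obtain ⟨R₂, h₂, hD23⟩ := hD M a hMa
  refine ⟨max R₁' R₂, lt_max_of_lt_left h₁, fun R₁ hR₁ ψ hψ hball ↦ ⟨?_, ?_⟩⟩
  · exact hD1 R₁ ((le_max_left _ _).trans hR₁) ψ hψ hball
  · exact hD23 R₁ ((le_max_right _ _).trans hR₁) ψ hψ hball

/-- **The gr.S24 pointwise decay from DRSR Theorems 3.1–3.2, the Dafermos–Rodnianski `r^p`
estimates, and (D2)–(D3)**: `Kerr.drsr_theorems_3_1_3_2_scri → Kerr.dafermosRodnianski_pHierarchy_scri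
→ (D2) ∧ (D3) → drsr_wave_pointwise_decay_kerr`, through
`Kerr.drsr_corollary_3_1_scri_flux_decay_of_hierarchy` (`KerrDecayHierarchy.lean`) and
`drsr_wave_pointwise_decay_kerr_of_flux_decay`. DRSR arXiv:1402.7034, §3.3 ("as a consequence of
this more general statement, the above theorems allow us to apply our black box result").
[cite: DafermosRodnianskiShlapentokhrothman2014, §3.3 Cor. 3.1 (30)] -/
theorem _root_.Literature.Geometry.Lorentzian.drsr_wave_pointwise_decay_kerr_of_hierarchy
    (hA : drsr_theorems_3_1_3_2_scri) (hB : dafermosRodnianski_pHierarchy_scri)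
    (hD : ∀ [Facts] [SliceFacts] (M a : ℝ), IsSubextremal M a →
        ∃ R₀ : ℝ, rPlus M a < R₀ ∧ ∀ R₁ : ℝ, R₀ ≤ R₁ →
          ∀ ψ : region a (rPlus M a) → ℝ, Literature.Geometry.Lorentzian.IsAdmissibleKerrWave M a ψ →
            HasBallData M a R₁ ψ →
              (∀ δ : ℝ, 0 < δ → ∃ C : ℝ, ∀ τ : ℝ, 1 ≤ τ →
                leafHessEnergy M a (scriHeight M a R₁) ψ τ ≤
                  ENNReal.ofReal (C * τ ^ (-4 + 2 * δ))) ∧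
              (∀ τ : ℝ, 1 ≤ τ → ∃ C₀ : ℝ, ∀ y ∈ (slice a (rPlus M a) : Set E3),
                ‖y‖ * |leafFun M a (scriHeight M a R₁) ψ τ y| ≤ C₀ ∧
                  ‖y‖ * ‖fderiv ℝ (leafFun M a (scriHeight M a R₁) ψ τ) y‖ ≤ C₀)) :
    Literature.Geometry.Lorentzian.drsr_wave_pointwise_decay_kerr :=
  Literature.Geometry.Lorentzian.drsr_wave_pointwise_decay_kerr_of_flux_decay
    (drsr_corollary_3_1_scri_flux_decay_of_hierarchy hA hB) hD

end Kerr

end Literature.Geometry.Lorentzian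

end
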